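import Summits.BirchSwinnertonDyer.Rank1Residual.Additive.CyclotomicThreeReduction
import Literature.NumberTheory.EllipticCurves.HondaStrongIsomorphismMultiplicativeProofs
import Literature.NumberTheory.EllipticCurves.PAdicBSDSplitMultiplicativeProofs
import Literature.NumberTheory.EllipticCurves.SzpiroLocalDataProofs
import HarnessLib

/-!
# The canonical model `V ⊗ K` of a curve with MULTIPLICATIVE reduction at `3` at the prime of
# `K = ℚ(ζ₃)` above `3`: minimality, (non-split) multiplicative reduction, and `ord₃ C(V ⊗ K) = ord₃ ∏ c_w`
# (line V15 of the additive sub-cell: the (M)-rows of X3/X4 at `p = 3`)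

HONEST FRAMING (cell `b2b-bsdres`, run/shared/lean/b2b/bsd-rank1-residual/, verbatim in every
file): the goal of the cell is to DELETE the COMBINATION-SHAPED residual classes of the
Birch–Swinnerton-Dyer formula for ALL analytic-rank `≤ 1` elliptic curves over `ℚ` — "full BSD
formula for every rank `≤ 1` curve in class `C`" assembled STRICTLY from published theorems — so
that the rank-`≤ 1` remainder becomes exactly the CONSTRUCTION-SHAPED classes, which are TYPED
(missing-input `Prop`s), NOT attempted. This is not "finishing BSD". Seat additive-p4 (research route
on X3/X4), gen 6; no label is changed by this file; nothing is booked here.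

Theorems only (no `def`, no `sorry`, no named fact). The `K`-side bookkeeping of line V15 — the
multiplicative twin of `CyclotomicThreeReduction` / `CyclotomicThreeDescentData` §1 (which treat a
prime of GOOD reduction): for `V/ℚ` globally minimal with MULTIPLICATIVE reduction at a prime `p`
and a number field `K`,

* `dvd_and_not_dvd_c₄_of_hasMultiplicativeReductionAtPrime` — `p ∣ Δ_min(V)`, `p ∤ c₄(V_ℤ)`
  (Silverman VII.5.1(b) read on the global minimal model);
* `isMinimalAt_and_hasMultiplicativeReductionAt_baseChange_of_mult` — at every place `w ∋ p` of
  `K` the model `V ⊗ K` is MINIMAL (unit `c₄`, Silverman VII.1 Remark 1.1) with multiplicative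
  reduction (any ramification: multiplicative reduction is stable under base change);
* `not_hasSplitMultiplicativeReductionAt_baseChange_of_not_split` — at a place `𝔭 ∋ 3` of residue
  degree one (`N𝔭 = 3`, e.g. the prime `(√−3)` of `ℚ(ζ₃)`), NON-split multiplicative reduction of
  `V` at `3` stays non-split for `V_K` at `𝔭` (the node-tangent quadratic of `V_ℤ` has no root in
  `𝔽₃ = k_𝔭`; tree `hasSplitMultiplicativeReductionAt_iff_splits` on both sides, model
  independence `hasSplitMultiplicativeReduction_iff_of_isMinimal_of_eq_smul`);
* `localTamagawaFactor_eq_of_isMinimalAt` — Dokchitser–Dokchitser's `C_w = c_w` at a place where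
  the model is minimal (`k_w = 0`), and hence
  `padicValRat_modifiedTamagawaProduct_baseChange_of_isMinimalAt` — `ord_p C(V ⊗ K) = ord_p ∏_w c_w(V_K)`
  as soon as `V ⊗ K` is minimal at the places above `p` (away from `p`: `C_w = c_w · N(w)^{k_w}`,
  `N(w)` prime to `p`, exactly as in `padicValRat_localTamagawaFactor_baseChange`); in particular
  `padicValRat_modifiedTamagawaProduct_baseChange_of_mult` for a multiplicative prime `p` of `V`.

These replace, on the (M)-rows, the good-reduction inputs `isMinimalAt_and_hasGoodReductionAt_baseChange_of_mem`
and `padicValRat_modifiedTamagawaProduct_baseChange` of line V14.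

References: Silverman *AEC* VII.1 Remark 1.1 and Prop. 1.3(b), VII.5 Prop. 5.1(b)
[SilvermanAEC2009]; T. & V. Dokchitser, Ann. of Math. 172 (2010) §1 Notation
[DokchitserDokchitserAnnals2010].
-/

noncomputable section

open scoped Classical NumberField

open WeierstrassCurve NumberField IsDedekindDomain Rat.HeightOneSpectrum
  Literature.NumberTheory.EllipticCurves Literature.NumberTheory.EllipticCurves.Rank1Residual

namespace Summit.BirchSwinnertonDyer.Rank1Residual.Additive

/-! ## §1 Integer data of a multiplicative prime of a globally minimal `V/ℚ` -/

section IntData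

variable (V : WeierstrassCurve ℚ) [V.IsElliptic] [V.IsGloballyMinimal] (p : ℕ) [hp : Fact p.Prime]

/-- **`p ∣ Δ_min(V)` and `p ∤ c₄(V_ℤ)` at a prime of multiplicative reduction** of the globally
minimal `V` (Silverman VII.5.1(b): `ord_p Δ > 0`, `ord_p c₄ = 0` on a minimal equation; tree
`hasMultiplicativeReductionAt_iff_of_isMinimalAt` at the place of `𝓞 ℚ` over `p`).
[cite: SilvermanAEC2009, VII.5 Prop. 5.1(b)] -/
theorem dvd_and_not_dvd_c₄_of_hasMultiplicativeReductionAtPrime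
    (h : V.HasMultiplicativeReductionAtPrime p) :
    (p : ℤ) ∣ minimalDiscriminantInt V ∧ ¬ (p : ℤ) ∣ (integralModelInt V).c₄ := by
  obtain ⟨v, hv⟩ : ∃ v : HeightOneSpectrum (𝓞 ℚ), (primesEquiv v : ℕ) = p :=
    ⟨primesEquiv.symm ⟨p, hp.out⟩, by rw [Equiv.apply_symm_apply]⟩
  subst hv
  have hm : V.HasMultiplicativeReductionAt v :=
    (hasMultiplicativeReductionAtPrime_iff_hasMultiplicativeReductionAt_ringOfIntegers V v).mp h
  rw [hasMultiplicativeReductionAt_iff_of_isMinimalAt (IsGloballyMinimal.isMinimal (W := V) v)] at hm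
  obtain ⟨hΔ, hc⟩ := hm
  have hc' : V.c₄ = ((integralModelInt V).c₄ : ℚ) := by
    conv_lhs => rw [← map_integralModelInt V]
    rw [map_c₄, eq_intCast]
  rw [← cast_minimalDiscriminantInt, (valuation_equiv_padicValuation v).lt_one_iff_lt_one,
    Rat.padicValuation_cast, Int.padicValuation_lt_one_iff] at hΔ
  rw [hc', (valuation_equiv_padicValuation v).eq_one_iff_eq_one, Rat.padicValuation_cast,
    Int.padicValuation_eq_one_iff] at hc
  exact ⟨hΔ, hc⟩

/-- **Non-split multiplicative reduction at `p` read on `V_ℤ mod p`**: the node-tangent quadratic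
`c₄T² + a₁c₄T − (54b₆ − 3b₂b₄ + a₂c₄)` of `integralModelInt V` does NOT split over `𝔽_p`
(tree `hasSplitMultiplicativeReductionAt_iff_splits` + the prime/place bridge).
[cite: SilvermanAEC2009, VII.5 Prop. 5.1(b)] -/
theorem not_splits_nodal_of_not_hasSplitMultiplicativeReductionAtPrime
    (h : V.HasMultiplicativeReductionAtPrime p) (hns : ¬ V.HasSplitMultiplicativeReductionAtPrime p) :
    ¬ (letI I := (integralModelInt V).map (Int.castRingHom (ZMod p));
        (Polynomial.C I.c₄ * Polynomial.X ^ 2 + Polynomial.C (I.a₁ * I.c₄) * Polynomial.X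
          - Polynomial.C (54 * I.b₆ - 3 * I.b₂ * I.b₄ + I.a₂ * I.c₄)).Splits) := by
  obtain ⟨hΔ, hc⟩ := dvd_and_not_dvd_c₄_of_hasMultiplicativeReductionAtPrime V p h
  obtain ⟨v, hv⟩ : ∃ v : HeightOneSpectrum (𝓞 ℚ), (primesEquiv v : ℕ) = p :=
    ⟨primesEquiv.symm ⟨p, hp.out⟩, by rw [Equiv.apply_symm_apply]⟩
  subst hv
  intro hs
  apply hns
  rw [hasSplitMultiplicativeReductionAtPrime_iff_hasSplitMultiplicativeReductionAt V v,
    V.hasSplitMultiplicativeReductionAt_iff_splits v hΔ hc]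
  exact hs

end IntData

/-! ## §2 The model `V ⊗ K` at the places above a multiplicative prime -/

section BaseChange

variable {K : Type} [Field K] [NumberField K]
  (V : WeierstrassCurve ℚ) [V.IsElliptic] [V.IsGloballyMinimal]

/-- **`V ⊗ K` is minimal with multiplicative reduction at every place `w ∋ p`** when `V/ℚ` (globally
minimal) has multiplicative reduction at `p`: `c₄(V_ℤ)` is a `p`-adic unit, hence a `w`-adic unit,
so the integral equation `V_ℤ ⊗ 𝒪_w` is minimal (Silverman VII.1 Remark 1.1) with `ord_w Δ > 0`,
`ord_w c₄ = 0` (VII.5.1(b)). [cite: SilvermanAEC2009, VII.1 Remark 1.1 and VII.5 Prop. 5.1(b)] -/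
theorem isMinimalAt_and_hasMultiplicativeReductionAt_baseChange_of_mult {p : ℕ} [hp : Fact p.Prime]
    (hmult : V.HasMultiplicativeReductionAtPrime p) (w : HeightOneSpectrum (𝓞 K))
    (hpw : (p : 𝓞 K) ∈ w.asIdeal) :
    (V.baseChange K).IsMinimalAt w ∧ (V.baseChange K).HasMultiplicativeReductionAt w := by
  haveI : (V.baseChange K).IsElliptic := by rw [baseChange]; infer_instance
  obtain ⟨hΔ, hc⟩ := dvd_and_not_dvd_c₄_of_hasMultiplicativeReductionAtPrime V p hmult
  have hint : (V.baseChange K).IsIntegralAt w := by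
    rw [← baseChange_integralModelInt_eq]
    exact isIntegralAt_baseChange_intModel (integralModelInt V) w
  have hc4 : w.valuation K (V.baseChange K).c₄ = 1 := by
    rw [← baseChange_integralModelInt_eq, baseChange, map_c₄, eq_intCast,
      ← map_intCast (algebraMap (𝓞 K) K), HeightOneSpectrum.valuation_of_algebraMap,
      HeightOneSpectrum.intValuation_eq_one_iff]
    exact intCast_notMem_asIdeal_of_not_dvd w hp.out hpw hc
  have hΔw : w.valuation K (V.baseChange K).Δ < 1 := by
    rw [← baseChange_integralModelInt_eq, baseChange, map_Δ, eq_intCast,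
      ← map_intCast (algebraMap (𝓞 K) K), HeightOneSpectrum.valuation_of_algebraMap,
      HeightOneSpectrum.intValuation_lt_one_iff_mem]
    obtain ⟨m, hm⟩ := hΔ
    have : ((minimalDiscriminantInt V : ℤ) : 𝓞 K) = (p : 𝓞 K) * (m : 𝓞 K) := by
      rw [hm]; push_cast; ring
    rw [show ((integralModelInt V).Δ : 𝓞 K) = ((minimalDiscriminantInt V : ℤ) : 𝓞 K) from rfl, this]
    exact Ideal.mul_mem_right _ _ hpw
  have hmin : (V.baseChange K).IsMinimalAt w := isMinimalAt_of_valuation_c₄_eq_one hint hc4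
  exact ⟨hmin, (hasMultiplicativeReductionAt_iff_of_isMinimalAt hmin).mpr ⟨hΔw, hc4⟩⟩

/-- **Non-split stays non-split at a place of residue degree one.** For `V/ℚ` globally minimal with
NON-split multiplicative reduction at `3` and a place `𝔭` of `K` with `3 ∈ 𝔭`, `N(𝔭) = 3` (e.g.
`K = ℚ(ζ₃)`, `𝔭 = (√−3)`): `V_K` does not have split multiplicative reduction at `𝔭`. The chosen
minimal model of `V_K ⊗ K_𝔭` and the minimal equation `V_ℤ ⊗ 𝒪_𝔭` have the same splitting
behaviour (model independence), the node-tangent quadratic of the latter is that of `V_ℤ` mapped to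
`k_𝔭 ≃ ℤ/3`, and over `ℤ/3` it does not split (non-split at `3` over `ℚ`).
[cite: SilvermanAEC2009, VII.5 Prop. 5.1(b) and VII.1 Prop. 1.3(b)] -/
theorem not_hasSplitMultiplicativeReductionAt_baseChange_of_not_split (𝔭 : HeightOneSpectrum (𝓞 K))
    (h3 : ((3 : ℕ) : 𝓞 K) ∈ 𝔭.asIdeal) (hN : Ideal.absNorm 𝔭.asIdeal = 3)
    (hmult : V.HasMultiplicativeReductionAtPrime 3) (hns : ¬ V.HasSplitMultiplicativeReductionAtPrime 3) :
    ¬ (V.baseChange K).HasSplitMultiplicativeReductionAt 𝔭 := by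
  haveI : (V.baseChange K).IsElliptic := by rw [baseChange]; infer_instance
  set R := 𝔭.adicCompletionIntegers K with hR
  set X : WeierstrassCurve (𝔭.adicCompletion K) := (V.baseChange K).baseChange (𝔭.adicCompletion K)
    with hX
  haveI hmin : X.IsMinimal R :=
    (isMinimalAt_and_hasMultiplicativeReductionAt_baseChange_of_mult V (p := 3) hmult 𝔭 h3).1
  have hΔX : X.Δ ≠ 0 := by
    rw [hX, baseChange, map_Δ, baseChange, map_Δ]
    refine (map_ne_zero _).mpr ((map_ne_zero _).mpr V.isUnit_Δ.ne_zero)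
  obtain ⟨D, hD⟩ : ∃ D : VariableChange (𝔭.adicCompletion K),
      (V.baseChange K).localMinimalModel 𝔭 = D • X := ⟨_, rfl⟩
  -- the integral model of `X` is `V_ℤ ⊗ 𝒪_𝔭`
  have h2 : X.integralModel R = (integralModelInt V).map (Int.castRingHom R) := by
    refine integralModel_eq_of_baseChange_eq _ _ ?_
    rw [hX]
    conv_rhs => rw [← map_integralModelInt V]
    rw [baseChange, baseChange, baseChange, map_map, map_map, map_map]
    exact congrArg (integralModelInt V).map (RingHom.ext_int _ _)
  -- the residue field has three elements
  have hk : Nat.card (IsLocalRing.ResidueField R) = 3 :=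
    natCard_residueField_adicCompletionIntegers_eq_three 𝔭 hN
  haveI : Finite (IsLocalRing.ResidueField R) := Nat.finite_of_card_ne_zero (by rw [hk]; norm_num)
  letI : Fintype (IsLocalRing.ResidueField R) := Fintype.ofFinite _
  have hcard : Fintype.card (IsLocalRing.ResidueField R) = 3 := by rw [Fintype.card_eq_nat_card, hk]
  let e : ZMod 3 ≃+* IsLocalRing.ResidueField R :=
    ZMod.ringEquivOfPrime (IsLocalRing.ResidueField R) Nat.prime_three hcard
  intro hsplit
  unfold HasSplitMultiplicativeReductionAt at hsplit
  rw [hD, hasSplitMultiplicativeReduction_iff_of_isMinimal_of_eq_smul R rfl hΔX,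
    hasSplitMultiplicativeReduction_iff] at hsplit
  have hs := hsplit.snd
  rw [h2, nodalTangents_map, Polynomial.map_map] at hs
  have hring : (algebraMap R (IsLocalRing.ResidueField R)).comp (Int.castRingHom R) =
      (e : ZMod 3 →+* IsLocalRing.ResidueField R).comp (Int.castRingHom (ZMod 3)) :=
    RingHom.ext_int _ _
  rw [hring, ← Polynomial.map_map, splits_map_ringEquiv_iff e, ← nodalTangents_map] at hs
  exact not_splits_nodal_of_not_hasSplitMultiplicativeReductionAtPrime V 3 hmult hns hs

end BaseChange

/-! ## §3 Dokchitser–Dokchitser's `C(V ⊗ K)` versus `∏ c_w(V_K)` when `V ⊗ K` is minimal above `p` -/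

section Tamagawa

variable {K : Type} [Field K] [NumberField K]

/-- **`C_w(X) = c_w(X)` at a place where the model `X` is minimal** (`k_w = 0`: the invariant
differential of a minimal equation is a Néron differential at `w`; `ord_w Δ_X = ord_w Δ_min`, tree
`valuation_Δ_eq_of_isMinimalAt`). [cite: DokchitserDokchitserAnnals2010, §1 Notation (arXiv pp. 4–5)] -/
theorem localTamagawaFactor_eq_of_isMinimalAt (X : WeierstrassCurve K) [X.IsElliptic]
    (w : HeightOneSpectrum (𝓞 K)) (hmin : X.IsMinimalAt w) :
    X.localTamagawaFactor w =
      ((X.baseChange (w.adicCompletion K)).localTamagawaNumber (w.adicCompletionIntegers K) : ℚ) := by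
  have h := valuation_Δ_eq_of_isMinimalAt_holds (v := w) (W := X) hmin
  rw [localTamagawaFactor_def, WeierstrassCurve.neronExponent, h, WithZero.log_exp]
  simp

variable (V : WeierstrassCurve ℚ) [V.IsElliptic] [V.IsGloballyMinimal] (p : ℕ) [hp : Fact p.Prime]

omit [V.IsGloballyMinimal] in
/-- **`ord_p C_w(V ⊗ K) = ord_p c_w(V_K)` at every finite place `w`** as soon as `V ⊗ K` is minimal at
the places above `p`: above `p` by `localTamagawaFactor_eq_of_isMinimalAt`; away from `p`,
`C_w = c_w · N(w)^{k_w}` with `N(w) = ℓ^{f_w}`, `ℓ ≠ p` (verbatim the second half of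
`padicValRat_localTamagawaFactor_baseChange`). [cite: DokchitserDokchitserAnnals2010, §1 Notation (arXiv pp. 4–5)] -/
theorem padicValRat_localTamagawaFactor_baseChange_of_isMinimalAt
    (hmin : ∀ w : HeightOneSpectrum (𝓞 K), (p : 𝓞 K) ∈ w.asIdeal → (V.baseChange K).IsMinimalAt w)
    (w : HeightOneSpectrum (𝓞 K)) :
    padicValRat p ((V.baseChange K).localTamagawaFactor w) =
      padicValNat p (((V.baseChange K).baseChange (w.adicCompletion K)).localTamagawaNumber
        (w.adicCompletionIntegers K)) := by
  haveI : (V.baseChange K).IsElliptic := by rw [baseChange]; infer_instance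
  obtain ⟨ℓ, hℓ, hℓw⟩ : ∃ ℓ : ℕ, ℓ.Prime ∧ (ℓ : 𝓞 K) ∈ w.asIdeal :=
    ⟨_, Nat.absNorm_under_prime w.asIdeal, Int.absNorm_under_mem w.asIdeal⟩
  by_cases hℓp : ℓ = p
  · subst hℓp
    rw [localTamagawaFactor_eq_of_isMinimalAt (V.baseChange K) w (hmin w hℓw), padicValRat.of_nat]
  · haveI : w.asIdeal.LiesOver (Ideal.span {(ℓ : ℤ)}) := Ideal.liesOver_span_of_natCast_mem' hℓ hℓw
    have hN : Ideal.absNorm w.asIdeal = ℓ ^ ((Ideal.span {(ℓ : ℤ)}).inertiaDeg' w.asIdeal) :=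
      Ideal.absNorm_eq_pow_inertiaDeg' w.asIdeal hℓ
    have hc0 : (((V.baseChange K).baseChange (w.adicCompletion K)).localTamagawaNumber
        (w.adicCompletionIntegers K) : ℚ) ≠ 0 := by
      exact_mod_cast (V.baseChange K).localTamagawaNumber_baseChange_ne_zero w
    have hN0 : ((Ideal.absNorm w.asIdeal : ℕ) : ℚ) ≠ 0 := by
      rw [hN]; exact_mod_cast pow_ne_zero _ hℓ.ne_zero
    have hvN : padicValRat p ((Ideal.absNorm w.asIdeal : ℕ) : ℚ) = 0 := by
      haveI : Fact ℓ.Prime := ⟨hℓ⟩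
      rw [hN, padicValRat.of_nat, Nat.cast_eq_zero, padicValNat.pow,
        padicValNat_primes (Ne.symm hℓp), mul_zero]
    rw [localTamagawaFactor_def, padicValRat.mul hc0 (zpow_ne_zero _ hN0), padicValRat.zpow, hvN,
      mul_zero, add_zero, padicValRat.of_nat]

/-- **`ord_p C(V ⊗ K) = ord_p ∏_w c_w(V_K)`** for the canonical model `V ⊗ K` of a globally minimal
`V/ℚ` that is MINIMAL at the places of `K` above `p` (the proof of
`padicValRat_modifiedTamagawaProduct_baseChange` with the good-reduction input replaced by
minimality). [cite: DokchitserDokchitserAnnals2010, §1 Notation (arXiv pp. 4–5)] -/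
theorem padicValRat_modifiedTamagawaProduct_baseChange_of_isMinimalAt
    (hmin : ∀ w : HeightOneSpectrum (𝓞 K), (p : 𝓞 K) ∈ w.asIdeal → (V.baseChange K).IsMinimalAt w) :
    padicValRat p (V.baseChange K).modifiedTamagawaProduct =
      padicValNat p (V.baseChange K).tamagawaProduct := by
  set VK := V.baseChange K with hVK
  set c : HeightOneSpectrum (𝓞 K) → ℕ := fun w ↦
    (VK.baseChange (w.adicCompletion K)).localTamagawaNumber (w.adicCompletionIntegers K) with hc
  set C : HeightOneSpectrum (𝓞 K) → ℚ := fun w ↦ VK.localTamagawaFactor w with hC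
  have hfin_c : (Function.mulSupport c).Finite := VK.mulSupport_localTamagawaNumber_finite_holds
  have hΔ0 : (integralModelInt V).Δ ≠ 0 := minimalDiscriminantInt_ne_zero V
  have hfin_C : (Function.mulSupport C).Finite := by
    have hI : (Ideal.span {((integralModelInt V).Δ : 𝓞 K)} : Ideal (𝓞 K)) ≠ 0 := by
      rw [Ne, Ideal.zero_eq_bot, Ideal.span_singleton_eq_bot]
      exact_mod_cast hΔ0
    refine (Ideal.finite_factors hI).subset fun w hw ↦ ?_
    rw [Function.mem_mulSupport] at hw
    rw [Set.mem_setOf_eq, Ideal.dvd_span_singleton]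
    by_contra hnot
    apply hw
    obtain ⟨ℓ, hℓ, hℓw⟩ : ∃ ℓ : ℕ, ℓ.Prime ∧ (ℓ : 𝓞 K) ∈ w.asIdeal :=
      ⟨_, Nat.absNorm_under_prime w.asIdeal, Int.absNorm_under_mem w.asIdeal⟩
    have hd : ¬ (ℓ : ℤ) ∣ (integralModelInt V).Δ := by
      rintro ⟨m, hm⟩
      apply hnot
      have : ((integralModelInt V).Δ : 𝓞 K) = (ℓ : 𝓞 K) * (m : 𝓞 K) := by
        rw [hm]; push_cast; ring
      rw [this]
      exact Ideal.mul_mem_right _ _ hℓw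
    have h1 := localTamagawaFactor_baseChange_int_eq_one (L := K) (integralModelInt V) hΔ0 w hℓ hℓw hd
    rw [baseChange_integralModelInt_eq] at h1
    exact h1
  obtain ⟨s, hs_c, hs_C⟩ : ∃ s : Finset (HeightOneSpectrum (𝓞 K)),
      Function.mulSupport c ⊆ s ∧ Function.mulSupport C ⊆ s := by
    refine ⟨hfin_c.toFinset ∪ hfin_C.toFinset, ?_, ?_⟩
    · intro w hw
      simp only [Finset.coe_union, Set.Finite.coe_toFinset, Set.mem_union]
      exact Or.inl hw
    · intro w hw
      simp only [Finset.coe_union, Set.Finite.coe_toFinset, Set.mem_union]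
      exact Or.inr hw
  have hTam : VK.tamagawaProduct = ∏ w ∈ s, c w := by
    rw [WeierstrassCurve.tamagawaProduct]
    exact finprod_eq_prod_of_mulSupport_subset c hs_c
  have hMod : VK.modifiedTamagawaProduct = ∏ w ∈ s, C w := by
    rw [modifiedTamagawaProduct_def]
    exact finprod_eq_prod_of_mulSupport_subset C hs_C
  rw [hMod, hTam, ← padicValRat.of_nat, Nat.cast_prod]
  have hterm : ∀ w, padicValRat p (C w) = padicValRat p ((c w : ℕ) : ℚ) := by
    intro w
    rw [padicValRat.of_nat]
    exact padicValRat_localTamagawaFactor_baseChange_of_isMinimalAt V p hmin w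
  have hC0 : ∀ w, C w ≠ 0 := fun w ↦ by
    show VK.localTamagawaFactor w ≠ 0
    rw [localTamagawaFactor_def]
    refine mul_ne_zero ?_ (zpow_ne_zero _ ?_)
    · exact_mod_cast VK.localTamagawaNumber_baseChange_ne_zero w
    · have h : Ideal.absNorm w.asIdeal ≠ 0 := by
        rw [Ne, Ideal.absNorm_eq_zero_iff]
        exact w.ne_bot
      exact_mod_cast h
  have hc0 : ∀ w, ((c w : ℕ) : ℚ) ≠ 0 := fun w ↦ by
    exact_mod_cast VK.localTamagawaNumber_baseChange_ne_zero w
  have key : ∀ t : Finset (HeightOneSpectrum (𝓞 K)),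
      padicValRat p (∏ w ∈ t, C w) = padicValRat p (∏ w ∈ t, ((c w : ℕ) : ℚ)) := by
    intro t
    induction t using Finset.induction_on with
    | empty => simp
    | insert a t hat ih =>
      rw [Finset.prod_insert hat, Finset.prod_insert hat,
        padicValRat.mul (hC0 a) (Finset.prod_ne_zero_iff.mpr fun w _ ↦ hC0 w),
        padicValRat.mul (hc0 a) (Finset.prod_ne_zero_iff.mpr fun w _ ↦ hc0 w), hterm a, ih]
  exact key s

/-- **`ord_p C(V ⊗ K) = ord_p ∏_w c_w(V_K)` at a MULTIPLICATIVE prime `p` of `V`** (the model `V ⊗ K`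
is minimal above `p` by `isMinimalAt_and_hasMultiplicativeReductionAt_baseChange_of_mult`).
[cite: DokchitserDokchitserAnnals2010, §1 Notation (arXiv pp. 4–5)] -/
theorem padicValRat_modifiedTamagawaProduct_baseChange_of_mult
    (hmult : V.HasMultiplicativeReductionAtPrime p) :
    padicValRat p (V.baseChange K).modifiedTamagawaProduct =
      padicValNat p (V.baseChange K).tamagawaProduct :=
  padicValRat_modifiedTamagawaProduct_baseChange_of_isMinimalAt V p fun w hw ↦
    (isMinimalAt_and_hasMultiplicativeReductionAt_baseChange_of_mult V hmult w hw).1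

end Tamagawa

end Summit.BirchSwinnertonDyer.Rank1Residual.Additive

end
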